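import Summits.CriticalPhenomena.PercolationContinuityZ3.Theorems.PercNearOneGluingNoHeavyLowerTailOneCutCentral
import Summits.CriticalPhenomena.PercolationContinuityZ3.Theorems.PercNearOneGluingNoHeavyLowerTailOneCutConst
import HarnessLib

/-!
# `NoHeavyLowerTail` (stmt-CriticalPhenomena-4575) — calibration: the one-cut engine needs only a MODULUS,
# the LEVEL may shrink with `ε`, and the engine is the MEAN-CONNECTION statement `E N / |A| → 1`

Support file (engine seat `prim-cplus-engine` g2; `--supports stmt-CriticalPhenomena-4575`).  Bookkeeping only:
no definitions, no named facts, no sorries.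

Notation: `μ = prodBernoulli w` on `Fin n`, relay set `A` (`k = |A|`), observer `o`,
`N = |{a ∈ A : o ↔ a}|`, `E N = Σ_{a∈A} P(o ↔ a)`, `t ≥` every `P(a ↮ a')` (`a ≠ a' ∈ A`),
`δ₀ = P(o ↮ A)`.

Every reduction of the crux through the one-cut line recorded so far is LINEAR
(`Theorems.noHeavyLowerTail_of_oneCut`: `P(1 ≤ N < E N/2) ≤ t`; `Theorems.noHeavyLowerTail_of_oneCut_const`:
`≤ C·t` at a fixed fraction `ρ₀`).  The crux quantifies `∀ ε ∃ δ` and its window is `N < (δ/ε)·E N`, so three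
further weakenings are free, and this file records them as reductions:

* `noHeavyLowerTail_of_oneCut_modulus` — **ONE-CUT WITH A MODULUS**: it suffices that for every `ε > 0`
  there are `ρ > 0` and `τ > 0` with `P(1 ≤ N ∧ N < ρ·E N) ≤ ε` on every finite weighted graph whose
  pairwise relay disconnections and whose `P(o ↮ A)` are all `≤ τ`.  So (i) ANY modulus `φ(t, δ₀) → 0`
  replaces `C·t` — `√t`, `t·log(1/t)`, `δ₀^{1/3}`, … are admissible (only `|A|`- and graph-UNIFORMITY
  matters; a `log |A|` is not admissible, cf. `Theorems.oneCut_logLoss`); (ii) the LEVEL `ρ = ρ(ε)` may tend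
  to `0` with `ε` (bounds like `C·(ρ + t/ρ^c)` are admissible); (iii) the observer budget `δ₀ = P(o ↮ A)` may
  enter the modulus.  Consequently two-copy / Cauchy–Schwarz decouplings, second-moment (Paley–Zygmund)
  steps and the van den Berg–Kahn disjoint-pocket inequality `P(∅ ≠ π ⊆ U₁)·P(∅ ≠ π ⊆ U₂) ≤ δ₀`
  (`U₁ ∩ U₂ = ∅`; tree: `VandenbergKahn2001_connectionSeparation`), all of which lose square roots,
  are legitimate tools for the engine.
* `oneCut_modulus_of_meanConnection`, `noHeavyLowerTail_of_meanConnection` — **MEAN CONNECTION**: it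
  suffices that `E N ≥ (1 − ε)·|A|` once `t, δ₀ ≤ τ(ε)`, i.e. that the AVERAGE over `b ∈ A` of `P(o ↔ b)`
  tends to `1` — Kozma–Nitzan's Conjecture 1 (`P(o ↔ b) ≥ P(o ↔ A)·min_a P(a ↔ b)` for EVERY `b`)
  averaged over the target `b ∈ A` and with an arbitrary modulus.  (Proof: the observer-hub Markov bound
  `Theorems.lowerTail_le_markov_self` at `θ = E N/2`.)  CONVERSELY (not formalised; three lines): since
  `Σ_b P(N ≥ 1, o ↮ b) = E[(k − N); N ≥ 1] ≤ k·P(1 ≤ N < k/2) + E[2N(k − N)/k] ≤ k·P(1 ≤ N < k/2) + 2(k−1)t`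
  (the pairs `(a, a')` with `a ∈ π(o) ∌ a'` are disconnected), one has
  `E N = k·P(N ≥ 1) − E[(k−N); N ≥ 1] ≥ k·(1 − δ₀ − 2t − P(1 ≤ N < k/2))`; so the linear one-cut bound at
  level `k/2` gives mean connection back, and the four statements (crux-type one-cut with modulus at level
  `1/2`, at level `ρ(ε)`, mean connection, and `E[k − N ; N ≥ 1] = o(k)`) are equivalent up to moduli.
  The content of the crux is therefore exactly: **given `P(o ↔ A) → 1` and pairwise `P(a ↔ a') → 1`
  uniformly, `E[N ∣ N ≥ 1]/|A| → 1` uniformly in the graph and in `|A|`.**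
* `oneCut_modulus_of_oneCut_const` — the registered engine `stub_oneCutConst` implies the modulus form
  (calibration: the new hypothesis is weaker).
-/

noncomputable section

namespace Summit.CriticalPhenomena.PercolationContinuityZ3.Theorems

open MeasureTheory Set Literature.Probability.LatticeModels Literature.Probability.Percolation
open Summit.CriticalPhenomena.PercolationContinuityZ3.Theses.PercNearOneGluing
open scoped Classical BigOperators

/-- **One-cut bound with a modulus (and a shrinking level) ⇒ `NoHeavyLowerTail`.**  If for every `ε > 0`
there are `ρ > 0` and `τ > 0` such that every finite weighted graph with all pairwise relay disconnection
probabilities `≤ τ` and `P(o ↮ A) ≤ τ` satisfies `P(1 ≤ N ∧ N < ρ·E N) ≤ ε`, then the crux holds, with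
`δ := min τ (ρ·ε) / 2` for the data of `ε/2`. [this work] -/
theorem noHeavyLowerTail_of_oneCut_modulus
    (hmod : ∀ ε : ℝ, 0 < ε → ∃ (ρ τ : ℝ), 0 < ρ ∧ 0 < τ ∧ ∀ (n : ℕ) (w : Sym2 (Fin n) → unitInterval) (A : Finset (Fin n)) (o : Fin n), (∀ a ∈ A, ∀ a' ∈ A, a ≠ a' → (Literature.Probability.LatticeModels.prodBernoulli w).real (Literature.Probability.Percolation.openConn a a')ᶜ ≤ τ) → (Literature.Probability.LatticeModels.prodBernoulli w).real (⋃ a ∈ A, (Literature.Probability.Percolation.openConn o a : Set (Literature.Probability.Percolation.BondConfig (Fin n))))ᶜ ≤ τ → (Literature.Probability.LatticeModels.prodBernoulli w).real {ω : Literature.Probability.Percolation.BondConfig (Fin n) | 1 ≤ (A.filter fun a => ω ∈ Literature.Probability.Percolation.openConn o a).card ∧ ((A.filter fun a => ω ∈ Literature.Probability.Percolation.openConn o a).card : ℝ) < ρ * (∑ a ∈ A, (Literature.Probability.LatticeModels.prodBernoulli w).real (Literature.Probability.Percolation.openConn o a))} ≤ ε) :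
    Summit.CriticalPhenomena.PercolationContinuityZ3.Theses.PercNearOneGluing.NoHeavyLowerTail := by
  intro ε hε
  obtain ⟨ρ, τ, hρ, hτ, hcut⟩ := hmod (ε / 2) (by linarith)
  set δ : ℝ := min τ (ρ * ε) / 2 with hδdef
  have hmin_pos : 0 < min τ (ρ * ε) := lt_min hτ (mul_pos hρ hε)
  have hδ : 0 < δ := by rw [hδdef]; linarith
  have hδτ : δ ≤ τ := by
    rw [hδdef]; linarith [min_le_left τ (ρ * ε)]
  have hδρ : δ ≤ ρ * ε / 2 := by
    rw [hδdef]; linarith [min_le_right τ (ρ * ε)]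
  refine ⟨δ, hδ, ?_⟩
  intro n w A o hU hpair
  set μ := prodBernoulli w with hμ
  -- both budgets are `< δ ≤ τ`
  have ht : ∀ a ∈ A, ∀ a' ∈ A, a ≠ a' → μ.real (openConn a a')ᶜ ≤ τ := by
    intro a ha a' ha' _
    rw [probReal_compl_eq_one_sub (measurableSet_openConn_holds a a')]
    linarith [hpair a ha a' ha']
  have hU' : μ.real (⋃ a ∈ A, (openConn o a : Set (BondConfig (Fin n))))ᶜ ≤ τ := by
    rw [probReal_compl_eq_one_sub
      (Finset.measurableSet_biUnion A fun a _ => measurableSet_openConn_holds o a)]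
    linarith
  have key := hcut n w A o ht hU'
  have hEN : 0 ≤ ∑ a ∈ A, μ.real (openConn o a) := Finset.sum_nonneg fun a _ => measureReal_nonneg
  -- the crux event (threshold `δ·EN/ε`) lies inside the engine event (threshold `ρ·EN`)
  have hsub : {ω : BondConfig (Fin n) | 1 ≤ (A.filter fun a => ω ∈ openConn o a).card ∧
        ((A.filter fun a => ω ∈ openConn o a).card : ℝ) <
          δ * (∑ a ∈ A, μ.real (openConn o a)) / ε} ⊆
      {ω : BondConfig (Fin n) | 1 ≤ (A.filter fun a => ω ∈ openConn o a).card ∧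
        ((A.filter fun a => ω ∈ openConn o a).card : ℝ) <
          ρ * (∑ a ∈ A, μ.real (openConn o a))} := by
    rintro ω ⟨h1, h2⟩
    refine ⟨h1, lt_of_lt_of_le h2 ?_⟩
    have hratio : δ / ε ≤ ρ := by
      rw [div_le_iff₀ hε]; nlinarith
    calc δ * (∑ a ∈ A, μ.real (openConn o a)) / ε
        = (δ / ε) * (∑ a ∈ A, μ.real (openConn o a)) := by ring
      _ ≤ ρ * (∑ a ∈ A, μ.real (openConn o a)) := mul_le_mul_of_nonneg_right hratio hEN
  calc μ.real {ω : BondConfig (Fin n) | 1 ≤ (A.filter fun a => ω ∈ openConn o a).card ∧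
          ((A.filter fun a => ω ∈ openConn o a).card : ℝ) <
            δ * (∑ a ∈ A, μ.real (openConn o a)) / ε}
      ≤ μ.real {ω : BondConfig (Fin n) | 1 ≤ (A.filter fun a => ω ∈ openConn o a).card ∧
          ((A.filter fun a => ω ∈ openConn o a).card : ℝ) <
            ρ * (∑ a ∈ A, μ.real (openConn o a))} := measureReal_mono hsub
    _ ≤ ε / 2 := key
    _ < ε := by linarith

/-- **Mean connection ⇒ one-cut with a modulus (level `1/2`).**  If for every `ε > 0` there is `τ > 0` such
that `(1 − ε)·|A| ≤ E N = Σ_{a∈A} P(o ↔ a)` on every finite weighted graph whose pairwise relay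
disconnections and `P(o ↮ A)` are `≤ τ`, then `P(1 ≤ N ∧ N < E N/2) ≤ 2ε` there (observer-hub Markov
bound `Theorems.lowerTail_le_markov_self` at `θ = E N/2`); stated with `ε/2 ↦ ε`. [this work] -/
theorem oneCut_modulus_of_meanConnection
    (hmean : ∀ ε : ℝ, 0 < ε → ∃ τ : ℝ, 0 < τ ∧ ∀ (n : ℕ) (w : Sym2 (Fin n) → unitInterval) (A : Finset (Fin n)) (o : Fin n), (∀ a ∈ A, ∀ a' ∈ A, a ≠ a' → (Literature.Probability.LatticeModels.prodBernoulli w).real (Literature.Probability.Percolation.openConn a a')ᶜ ≤ τ) → (Literature.Probability.LatticeModels.prodBernoulli w).real (⋃ a ∈ A, (Literature.Probability.Percolation.openConn o a : Set (Literature.Probability.Percolation.BondConfig (Fin n))))ᶜ ≤ τ → (1 - ε) * (A.card : ℝ) ≤ ∑ a ∈ A, (Literature.Probability.LatticeModels.prodBernoulli w).real (Literature.Probability.Percolation.openConn o a)) :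
    ∀ ε : ℝ, 0 < ε → ∃ (ρ τ : ℝ), 0 < ρ ∧ 0 < τ ∧ ∀ (n : ℕ) (w : Sym2 (Fin n) → unitInterval) (A : Finset (Fin n)) (o : Fin n), (∀ a ∈ A, ∀ a' ∈ A, a ≠ a' → (Literature.Probability.LatticeModels.prodBernoulli w).real (Literature.Probability.Percolation.openConn a a')ᶜ ≤ τ) → (Literature.Probability.LatticeModels.prodBernoulli w).real (⋃ a ∈ A, (Literature.Probability.Percolation.openConn o a : Set (Literature.Probability.Percolation.BondConfig (Fin n))))ᶜ ≤ τ → (Literature.Probability.LatticeModels.prodBernoulli w).real {ω : Literature.Probability.Percolation.BondConfig (Fin n) | 1 ≤ (A.filter fun a => ω ∈ Literature.Probability.Percolation.openConn o a).card ∧ ((A.filter fun a => ω ∈ Literature.Probability.Percolation.openConn o a).card : ℝ) < ρ * (∑ a ∈ A, (Literature.Probability.LatticeModels.prodBernoulli w).real (Literature.Probability.Percolation.openConn o a))} ≤ ε := by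
  intro ε hε
  obtain ⟨τ, hτ, hEN⟩ := hmean (ε / 2) (by linarith)
  refine ⟨1 / 2, τ, by norm_num, hτ, ?_⟩
  intro n w A o hpair hU
  set μ := prodBernoulli w with hμ
  -- empty relay set: the event is empty
  rcases A.eq_empty_or_nonempty with hA | hAne
  · subst hA
    simp [hε.le]
  have hcard_pos : (0 : ℝ) < A.card := by exact_mod_cast Finset.card_pos.mpr hAne
  set EN : ℝ := ∑ a ∈ A, μ.real (openConn o a) with hEN_def
  have hEN1 : EN ≤ A.card := by
    calc EN ≤ ∑ a ∈ A, (1 : ℝ) := Finset.sum_le_sum fun a _ => measureReal_le_one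
      _ = A.card := by simp
  have hmean' : (1 - ε / 2) * (A.card : ℝ) ≤ EN := hEN n w A o hpair hU
  have hθ : EN / 2 < A.card := by linarith
  have hden : 0 < (A.card : ℝ) - EN / 2 := by linarith
  have hsub : {ω : BondConfig (Fin n) | 1 ≤ (A.filter fun a => ω ∈ openConn o a).card ∧
        ((A.filter fun a => ω ∈ openConn o a).card : ℝ) < 1 / 2 * EN} ⊆
      {ω : BondConfig (Fin n) | ((A.filter fun a => ω ∈ openConn o a).card : ℝ) < EN / 2} := by
    rintro ω ⟨_, h2⟩
    simp only [mem_setOf_eq]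
    linarith
  calc μ.real {ω : BondConfig (Fin n) | 1 ≤ (A.filter fun a => ω ∈ openConn o a).card ∧
          ((A.filter fun a => ω ∈ openConn o a).card : ℝ) < 1 / 2 * EN}
      ≤ μ.real {ω : BondConfig (Fin n) | ((A.filter fun a => ω ∈ openConn o a).card : ℝ) < EN / 2} :=
        measureReal_mono hsub
    _ ≤ ((A.card : ℝ) - EN) / (A.card - EN / 2) := lowerTail_le_markov_self w A o (EN / 2) hθ
    _ ≤ ε := by
        rw [div_le_iff₀ hden]
        nlinarith

/-- **Mean connection ⇒ `NoHeavyLowerTail`.**  If the AVERAGE connection `(1/|A|) Σ_{a∈A} P(o ↔ a)` tends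
to `1` uniformly over finite weighted graphs as the pairwise relay disconnections and `P(o ↮ A)` tend to
`0` (Kozma–Nitzan's Conjecture 1 averaged over the target `b ∈ A`, with any modulus), then the crux holds.
Conversely the crux-type linear one-cut bound gives mean connection back (module docstring). [this work] -/
theorem noHeavyLowerTail_of_meanConnection
    (hmean : ∀ ε : ℝ, 0 < ε → ∃ τ : ℝ, 0 < τ ∧ ∀ (n : ℕ) (w : Sym2 (Fin n) → unitInterval) (A : Finset (Fin n)) (o : Fin n), (∀ a ∈ A, ∀ a' ∈ A, a ≠ a' → (Literature.Probability.LatticeModels.prodBernoulli w).real (Literature.Probability.Percolation.openConn a a')ᶜ ≤ τ) → (Literature.Probability.LatticeModels.prodBernoulli w).real (⋃ a ∈ A, (Literature.Probability.Percolation.openConn o a : Set (Literature.Probability.Percolation.BondConfig (Fin n))))ᶜ ≤ τ → (1 - ε) * (A.card : ℝ) ≤ ∑ a ∈ A, (Literature.Probability.LatticeModels.prodBernoulli w).real (Literature.Probability.Percolation.openConn o a)) :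
    Summit.CriticalPhenomena.PercolationContinuityZ3.Theses.PercNearOneGluing.NoHeavyLowerTail :=
  noHeavyLowerTail_of_oneCut_modulus (oneCut_modulus_of_meanConnection hmean)

/-- **Calibration: the registered linear engine `stub_oneCutConst` implies the modulus form** (with
`ρ := ρ₀`, `τ := ε / max C 1`; the observer budget is not even used). [this work] -/
theorem oneCut_modulus_of_oneCut_const
    (hconst : ∃ (C ρ₀ : ℝ), 0 < ρ₀ ∧ ∀ (n : ℕ) (w : Sym2 (Fin n) → unitInterval) (A : Finset (Fin n)) (o : Fin n) (t : ℝ), 0 ≤ t → (∀ a ∈ A, ∀ a' ∈ A, a ≠ a' → (Literature.Probability.LatticeModels.prodBernoulli w).real (Literature.Probability.Percolation.openConn a a')ᶜ ≤ t) → (Literature.Probability.LatticeModels.prodBernoulli w).real {ω : Literature.Probability.Percolation.BondConfig (Fin n) | 1 ≤ (A.filter fun a => ω ∈ Literature.Probability.Percolation.openConn o a).card ∧ ((A.filter fun a => ω ∈ Literature.Probability.Percolation.openConn o a).card : ℝ) < ρ₀ * (∑ a ∈ A, (Literature.Probability.LatticeModels.prodBernoulli w).real (Literature.Probability.Percolation.openConn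 o a))} ≤ C * t) :
    ∀ ε : ℝ, 0 < ε → ∃ (ρ τ : ℝ), 0 < ρ ∧ 0 < τ ∧ ∀ (n : ℕ) (w : Sym2 (Fin n) → unitInterval) (A : Finset (Fin n)) (o : Fin n), (∀ a ∈ A, ∀ a' ∈ A, a ≠ a' → (Literature.Probability.LatticeModels.prodBernoulli w).real (Literature.Probability.Percolation.openConn a a')ᶜ ≤ τ) → (Literature.Probability.LatticeModels.prodBernoulli w).real (⋃ a ∈ A, (Literature.Probability.Percolation.openConn o a : Set (Literature.Probability.Percolation.BondConfig (Fin n))))ᶜ ≤ τ → (Literature.Probability.LatticeModels.prodBernoulli w).real {ω : Literature.Probability.Percolation.BondConfig (Fin n) | 1 ≤ (A.filter fun a => ω ∈ Literature.Probability.Percolation.openConn o a).card ∧ ((A.filter fun a => ω ∈ Literature.Probability.Percolation.openConn o a).card : ℝ) < ρ * (∑ a ∈ A, (Literature.Probability.LatticeModels.prodBernoulli w).real (Literature.Probability.Percolation.openConn o a))} ≤ ε := by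
  obtain ⟨C, ρ₀, hρ₀, hcut⟩ := hconst
  intro ε hε
  set C' : ℝ := max C 1 with hC'def
  have hC'0 : 0 < C' := lt_of_lt_of_le one_pos (le_max_right _ _)
  have hCC' : C ≤ C' := le_max_left _ _
  refine ⟨ρ₀, ε / C', hρ₀, div_pos hε hC'0, ?_⟩
  intro n w A o hpair _hU
  have hτ0 : 0 ≤ ε / C' := (div_pos hε hC'0).le
  calc (prodBernoulli w).real {ω : BondConfig (Fin n) | 1 ≤ (A.filter fun a => ω ∈ openConn o a).card ∧
          ((A.filter fun a => ω ∈ openConn o a).card : ℝ) <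
            ρ₀ * (∑ a ∈ A, (prodBernoulli w).real (openConn o a))}
      ≤ C * (ε / C') := hcut n w A o (ε / C') hτ0 hpair
    _ ≤ C' * (ε / C') := mul_le_mul_of_nonneg_right hCC' hτ0
    _ = ε := by field_simp

end Summit.CriticalPhenomena.PercolationContinuityZ3.Theorems

end
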